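import Summits.QuantumFields.YangMills.Theorems.FemtoCutoffLadderWalledL2
import Summits.QuantumFields.YangMills.Theorems.FemtoTransferGapPhysL2Infinite
import Summits.QuantumFields.YangMills.Theorems.FlatTubeReductionOffTubeSuppressionPrelim
import HarnessLib

/-!
# The walled closed subspace is INFINITE-DIMENSIONAL (brick 2 of the walled spectral package — route `FemtoCutoffLadder`,
# crux `LocalWallStep` stmt-QuantumFields-26282, cancellation route)

Seat `leafhand-qf-femtocutoffladder-2` g0 (2026-08-30), `--supports stmt-QuantumFields-26282`.  The min–max / eigen-sequence package
(`Literature/Analysis/OperatorTheory/CompactPositiveMinMaxLevels`, `…EigenSequence`) asks for a Hilbert space that is NOT finite-dimensional.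
For the walled subspace `walledL2 L S` (✓p796175) this holds as soon as the measurable, gauge- and twist-invariant good set `S` contains an OPEN
set `O` on which the plaquette observable `plaqObs` takes infinitely many values (every SF wall set qualifies: `O = {∀ p, 2 − Re tr U_p < c}` contains
the two-link configurations `chartSU2(θe₀), chartSU2(e₁)` for small `θ`, where `plaqObs = 1 − 2θ²`):
* `indicator_plaqObsPow_mem_walledSub` — the walled powers `1_S · plaqObs^n` are walled physical test functions;
* ★ `linearIndependent_toL2_indicator_plaqObsPow` — their `L²` classes are linearly independent (a vanishing combination is a polynomial in
  `plaqObs` vanishing a.e. on `O`, hence on `O` — open null sets are empty by full support of the a-priori measure —, hence zero);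
* ★ `not_finiteDimensional_walledL2`.
HONEST FRAMING: fixed-lattice functional analysis; R2b1 RECORD rung — not infinite volume, not a mass gap, not Clay; no summit is proved by this
file.  No definitions, no named facts, no `sorry`.  [cite: ReedSimonIV1978, Thm. XIII.1]
-/

set_option autoImplicit false

noncomputable section

open MeasureTheory Filter Topology Real
open Literature.MathematicalPhysics.QuantumFieldTheory
open Literature.MathematicalPhysics.QuantumLattice
open Literature.Analysis.OperatorTheory
open scoped InnerProductSpace

namespace Summit.QuantumFields.YangMills.Theorems.FemtoTransferGap.PhysL2

open Summit.QuantumFields.YangMills.Theorems.FemtoTransferGap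

variable {L : ℕ} [NeZero L]

/-! ## §3 The walled closed subspace is infinite-dimensional (good sets with non-empty interior on which `plaqObs` is not finite-valued) -/

/-- Walled powers of the plaquette observable: `1_S · plaqObs^n` is a walled physical test function when `S` is measurable, gauge- and
twist-invariant. [folklore] -/
theorem indicator_plaqObsPow_mem_walledSub {S : Set (GaugeConfig 3 L SU2)} (hSm : MeasurableSet S)
    (hSg : ∀ (g : Site 3 L → SU2) (U : GaugeConfig 3 L SU2), gaugeTransform g U ∈ S ↔ U ∈ S)
    (hSz : ∀ (k : Fin 3), ∀ z ∈ Subgroup.center SU2, ∀ U : GaugeConfig 3 L SU2, twist k z U ∈ S ↔ U ∈ S) (n : ℕ) :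
    (⟨S.indicator fun U => plaqObs L U ^ n, OffTube.isPhys_indicator hSm hSg hSz (isPhys_plaqObs_pow n)⟩ : physSubmodule L) ∈
      walledSub L S := fun U hU => by
  change S.indicator (fun U => plaqObs L U ^ n) U = 0
  exact Set.indicator_of_notMem hU _

/-- ★ **Linear independence of the walled powers.**  If `O ⊆ S` is open and `plaqObs` takes infinitely many values on `O`, the `L²`
classes of `1_S · plaqObs^n`, `n ∈ ℕ`, are linearly independent: a vanishing combination is a polynomial in `plaqObs` vanishing a.e. on
`O`, hence on all of `O` (open sets of measure zero are empty — full support of the a-priori measure), hence the zero polynomial. [folklore] -/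
theorem linearIndependent_toL2_indicator_plaqObsPow {S O : Set (GaugeConfig 3 L SU2)} (hSm : MeasurableSet S)
    (hSg : ∀ (g : Site 3 L → SU2) (U : GaugeConfig 3 L SU2), gaugeTransform g U ∈ S ↔ U ∈ S)
    (hSz : ∀ (k : Fin 3), ∀ z ∈ Subgroup.center SU2, ∀ U : GaugeConfig 3 L SU2, twist k z U ∈ S ↔ U ∈ S)
    (hOS : O ⊆ S) (hO : IsOpen O) (hinf : (plaqObs L '' O).Infinite) :
    LinearIndependent ℝ (fun n : ℕ => toL2
      (⟨S.indicator fun U => plaqObs L U ^ n, OffTube.isPhys_indicator hSm hSg hSz (isPhys_plaqObs_pow n)⟩ : physSubmodule L)) := by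
  classical
  haveI := isOpenPosMeasure_configMeasure (L := L)
  set w : ℕ → physSubmodule L := fun n =>
    ⟨S.indicator fun U => plaqObs L U ^ n, OffTube.isPhys_indicator hSm hSg hSz (isPhys_plaqObs_pow n)⟩ with hw
  rw [linearIndependent_iff']
  intro s g hsum n hn
  have hlin : toL2 (∑ m ∈ s, g m • w m) = 0 := by
    rw [map_sum]
    simpa only [map_smul] using hsum
  -- the combination, pointwise
  have hfun : ∀ U, ((∑ m ∈ s, g m • w m : physSubmodule L) : GaugeConfig 3 L SU2 → ℝ) U =
      ∑ m ∈ s, g m * S.indicator (fun U => plaqObs L U ^ m) U := by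
    intro U
    rw [Submodule.coe_sum, Finset.sum_apply]
    simp only [Submodule.coe_smul, Pi.smul_apply, smul_eq_mul]
    rfl
  -- a.e. vanishing of the combination
  have hae : ((∑ m ∈ s, g m • w m : physSubmodule L) : GaugeConfig 3 L SU2 → ℝ) =ᵐ[configMeasure SU2 L]
      (0 : GaugeConfig 3 L SU2 → ℝ) := by
    have h2 := coeFn_toL2 (∑ m ∈ s, g m • w m)
    rw [hlin] at h2
    filter_upwards [h2, Lp.coeFn_zero ℝ 2 (configMeasure SU2 L)] with U hU h0
    rw [← hU, h0]
  -- the polynomial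
  set P : Polynomial ℝ := ∑ m ∈ s, Polynomial.monomial m (g m) with hP
  have hPeval : ∀ U ∈ O, P.eval (plaqObs L U) = ((∑ m ∈ s, g m • w m : physSubmodule L) : GaugeConfig 3 L SU2 → ℝ) U := by
    intro U hU
    rw [hfun U, hP, Polynomial.eval_finsetSum]
    refine Finset.sum_congr rfl fun m _ => ?_
    rw [Polynomial.eval_monomial, Set.indicator_of_mem (hOS hU)]
  have hPcont : Continuous fun U : GaugeConfig 3 L SU2 => P.eval (plaqObs L U) :=
    (Polynomial.continuous P).comp continuous_plaqObs
  -- the open set where `P ∘ plaqObs ≠ 0` inside `O` is null, hence empty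
  have hnull : (configMeasure SU2 L) (O ∩ {U | P.eval (plaqObs L U) ≠ 0}) = 0 := by
    refine measure_mono_null (fun U hU => ?_) (ae_iff.mp hae)
    simp only [Set.mem_inter_iff, Set.mem_setOf_eq] at hU
    simp only [Set.mem_setOf_eq, Pi.zero_apply]
    rw [← hPeval U hU.1]
    exact hU.2
  have hopen : IsOpen (O ∩ {U | P.eval (plaqObs L U) ≠ 0}) := hO.inter (isOpen_ne_fun hPcont continuous_const)
  have hempty : O ∩ {U | P.eval (plaqObs L U) ≠ 0} = ∅ :=
    (hopen.measure_eq_zero_iff (configMeasure SU2 L)).mp hnull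
  have heval : ∀ U ∈ O, P.eval (plaqObs L U) = 0 := by
    intro U hU
    by_contra h
    have : U ∈ O ∩ {U | P.eval (plaqObs L U) ≠ 0} := ⟨hU, h⟩
    rw [hempty] at this
    exact this
  have hroots : Set.Infinite {x : ℝ | P.IsRoot x} :=
    Set.Infinite.mono (by rintro _ ⟨U, hU, rfl⟩; exact heval U hU) hinf
  have hP0 : P = 0 := Polynomial.eq_zero_of_infinite_isRoot P hroots
  have hcoeff : P.coeff n = g n := by
    rw [hP, Polynomial.finsetSum_coeff]
    simp only [Polynomial.coeff_monomial]
    rw [Finset.sum_ite_eq' s n, if_pos hn]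
  rw [← hcoeff, hP0, Polynomial.coeff_zero]

/-- ★ **The walled closed subspace is infinite-dimensional** whenever the (measurable, gauge- and twist-invariant) good set `S` contains
an open set on which `plaqObs` takes infinitely many values. [folklore] -/
theorem not_finiteDimensional_walledL2 {S O : Set (GaugeConfig 3 L SU2)} (hSm : MeasurableSet S)
    (hSg : ∀ (g : Site 3 L → SU2) (U : GaugeConfig 3 L SU2), gaugeTransform g U ∈ S ↔ U ∈ S)
    (hSz : ∀ (k : Fin 3), ∀ z ∈ Subgroup.center SU2, ∀ U : GaugeConfig 3 L SU2, twist k z U ∈ S ↔ U ∈ S)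
    (hOS : O ⊆ S) (hO : IsOpen O) (hinf : (plaqObs L '' O).Infinite) :
    ¬ FiniteDimensional ℝ (walledL2 L S) := by
  intro hfin
  set w : ℕ → walledL2 L S := fun n =>
    ⟨toL2 (⟨S.indicator fun U => plaqObs L U ^ n, OffTube.isPhys_indicator hSm hSg hSz (isPhys_plaqObs_pow n)⟩ : physSubmodule L),
      walledCore_le_walledL2 S (toL2_mem_walledCore (indicator_plaqObsPow_mem_walledSub hSm hSg hSz n))⟩ with hw
  have hind : LinearIndependent ℝ w := by
    refine LinearIndependent.of_comp (walledL2 L S).subtype ?_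
    exact linearIndependent_toL2_indicator_plaqObsPow hSm hSg hSz hOS hO hinf
  have hind' : LinearIndependent ℝ (w ∘ (Fin.val : Fin (Module.finrank ℝ (walledL2 L S) + 1) → ℕ)) :=
    hind.comp _ Fin.val_injective
  have h := hind'.fintype_card_le_finrank
  rw [Fintype.card_fin] at h
  omega

end Summit.QuantumFields.YangMills.Theorems.FemtoTransferGap.PhysL2

end
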